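import Summits.BirchSwinnertonDyer.Rank1Residual.Supersingular.KobayashiMainConjecture

/-!
# Crux `SignedTransportAtTwo` (stmt-BirchSwinnertonDyer-20306, route `ThetaPartnerAtTwo`), line `birth`:
# stub `stub_nonvanishingTwo` — `ϖ · L♭_E ≠ 0` in `ℚ₂⟦T⟧` (lead prover bsd-wall-tp2-p1, `--supports`)

The registered stub `stub_nonvanishingTwo` of the BC3 birth skeleton of the crux
`Summit.BirchSwinnertonDyer.BirchSwinnertonDyer.Theses.ThetaPartnerAtTwo.SignedTransportAtTwo`
(skeleton `Cruxes/SignedTransportAtTwo/Lines/birth.lean`, composition `SignedTransportAtTwo_of`): on the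
theta habitat, for the newform `f` of `W`, a rational `ϖ` with `ϖ · Ω_W = Ω⁺_f` and a Pollack pair
`(L♯, L♭) = (L⁺, L⁻)` of `f` at `2`, the Néron-normalised signed `2`-adic `L`-function
`ϖ · ι(L♭)` is non-zero in `ℚ₂⟦T⟧` (`kobayashiL 1 L⁺ L⁻ = L⁻`).

The skeleton's docstring budgets this as "Rohrlich + interpolation at `2`"; on the tree's objects it is
BOOKKEEPING and needs none of the habitat hypotheses: `L⁻ ≠ 0` is a conjunct of `IsPollackPair`
(Pollack 2003 Thm. 5.6 / Cor. 5.11 shape), `ι : Λ → ℚ₂⟦T⟧` is injective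
(`iwasawaToPowerSeries_injective`), `ℚ₂⟦T⟧` is a domain, and `ϖ ≠ 0` because `Ω⁺_f > 0` for a
rational newform (`IsNewform0.plusPeriod_pos_holds`, Mazur–Tate–Teitelbaum §I.8) while
`ϖ · Ω_W = Ω⁺_f`. Nothing else is used; the unused habitat binders are kept so that the statement is
the registered signature verbatim.

References: [Pollack2003] Thm. 5.6, Cor. 5.11; [MazurTateTeitelbaum1986Invent] §I.8; [Kobayashi2003] (3.6).
-/

-- D-0017: single-problem summit, so `Summit.BirchSwinnertonDyer.BirchSwinnertonDyer.…` repeats a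
-- namespace BY DESIGN.
set_option linter.dupNamespace false
set_option autoImplicit false

noncomputable section

namespace Summit.BirchSwinnertonDyer.BirchSwinnertonDyer.Theorems

open scoped MatrixGroups ModularForm
open CongruenceSubgroup Literature Literature.NumberTheory.EllipticCurves
  Literature.NumberTheory.EllipticCurves.ModularForms
  Summit.BirchSwinnertonDyer.Rank1Residual.Supersingular

/-- **Stub `stub_nonvanishingTwo` of the birth skeleton of `SignedTransportAtTwo` (PROVED).** On the
theta habitat (the first four binders are not used), for the newform `f` of `W`, any `ϖ : ℚ` with
`ϖ · Ω_W = Ω⁺_f` and any Pollack pair `(L⁺, L⁻)` of `f` at `2`: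
`C(ϖ) · ι(kobayashiL 1 L⁺ L⁻) ≠ 0` in `ℚ₂⟦T⟧`. Proof: `Ω⁺_f > 0`
(`IsNewform0.plusPeriod_pos_holds`) forces `ϖ ≠ 0`; `kobayashiL 1 L⁺ L⁻ = L⁻ ≠ 0` by `IsPollackPair`;
`ι` is injective and `ℚ₂⟦T⟧` has no zero divisors.
[cite: Pollack2003, Thm. 5.6 and Cor. 5.11] [cite: MazurTateTeitelbaum1986Invent, §I.8 (8.6)] -/
theorem stub_nonvanishingTwo :
    ∀ (W : WeierstrassCurve ℚ) [W.IsElliptic] [W.IsGloballyMinimal],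
    ¬ W.HasCM → W.analyticRank = 0 → Rank1Residual.GoodSS W 2 → W.frobeniusTrace 2 = 0 →
    ∀ [NeZero (W.conductorNorm ℤ)] (f : CuspForm (CongruenceSubgroup.Gamma0 (W.conductorNorm ℤ)) 2),
      ModularForms.IsNewformOf W f →
    ∀ (ϖ : ℚ), (ϖ : ℝ) * W.realPeriodRat = ModularForms.plusPeriod f →
    ∀ (Lplus Lminus : IwasawaAlgebra 2),
      Summit.BirchSwinnertonDyer.Rank1Residual.Supersingular.IsPollackPair f 2 Lplus Lminus →
      PowerSeries.C (ϖ : ℚ_[2]) *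
        iwasawaToPowerSeries 2 (Summit.BirchSwinnertonDyer.Rank1Residual.Supersingular.kobayashiL 1 Lplus Lminus) ≠ 0 := by
  intro W _ _ _ _ _ _ _ f hf ϖ hϖ Lplus Lminus hPP
  have hpos : 0 < plusPeriod f := IsNewform0.plusPeriod_pos_holds hf.1 hf.coeffField_eq_bot
  have hϖ0 : ϖ ≠ 0 := by
    rintro rfl
    rw [Rat.cast_zero, zero_mul] at hϖ
    exact absurd hϖ hpos.ne
  have hL : kobayashiL (1 : ℤˣ) Lplus Lminus = Lminus := by
    unfold kobayashiL; rw [if_pos rfl]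
  have hLne : iwasawaToPowerSeries 2 (kobayashiL (1 : ℤˣ) Lplus Lminus) ≠ 0 := by
    rw [hL]
    intro h0
    exact hPP.2.1 (iwasawaToPowerSeries_injective 2 (by rw [h0, map_zero]))
  refine mul_ne_zero ?_ hLne
  exact (map_ne_zero_iff _ PowerSeries.C_injective).mpr (by exact_mod_cast hϖ0)

end Summit.BirchSwinnertonDyer.BirchSwinnertonDyer.Theorems

end
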